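import Summits.ResolutionOfSingularities.ResolutionOfSingularities.Theorems.WildConesCampaignW46HypersurfacesCharTwoNullPolarNear
import Summits.ResolutionOfSingularities.ResolutionOfSingularities.Theorems.WildConesCampaignW46HypersurfacesCharTwoSepClosed
import Summits.ResolutionOfSingularities.ResolutionOfSingularities.Theorems.WildConesCampaignW46HypersurfacesCharTwoMilnorGap
import Summits.ResolutionOfSingularities.ResolutionOfSingularities.Theorems.WildConesCampaignW46HypersurfacesCharTwoSidewaysForced
import Summits.ResolutionOfSingularities.ResolutionOfSingularities.Theorems.WildConesCampaignW46HypersurfacesCharTwoFieldsStatement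

/-!
# [OURS · L1 W4.6, rung (ii) at p = 2, every dimension n] PROOFS BY NAME of the FIELD-OF-DEFINITION predicates
# (`…HypersurfacesCharTwoFieldsStatement.lean`, fields rev 1) at `p = 2`, for every `n`

HONEST FRAMING. OURS: each closer instantiates a predicate `CampaignW46Hypersurfaces… (p n)` of the fields statement
file at `p = 2` and proves it BY NAME from this seat's gen-7 files `…HypersurfacesCharTwo{NullPolarNear,SepClosed}.lean`.
Route WildCones' typed point-blow-up dynamics; the polar matrix of the statements is
`CampaignW46.HypersurfacesCharTwo.polarMatrix (ser c)` by `rfl`. NOTHING here is a statement of the manuscript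
[Hironaka2017]; no FACT-LIST premise; AI review is weaker than expert review. Cell res-hironaka (LADDER-RESOLUTION rung
L, D-0089), slot W4.6, seat res-L1-s46-pv-4 (gen 7); host crux `ClassicalRegimes` (stmt-ResolutionOfSingularities-16884;
proved) — helper, `--supports`.

WHAT IS PROVED: `campaignW46Hypersurfaces<X>_two (n) : CampaignW46Hypersurfaces<X> 2 n` for `X ∈ {NullPolarNear,
HilbertTwoNearExists, FreePointIsNullPolar, NullPolarCubeCriterion, NullPolarDichotomy, HilbertTwoCensusAnyField,
SepClosedNearExists, SepClosedSecondNear, ThreeTangentsSepClosed, ResolvedInOneIffMuLeTwo}` and the conjunction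
`campaignW46HypersurfacesFields_two_all`.

REV 2 (same seat, gen 7, APPEND-ONLY: the eleven rev-1 theorems are byte-identical; one import added): closers of the three
rev-2 predicates `CampaignW46Hypersurfaces{MilnorTrichotomy, MuLeTwoResolved, NearForcesMuFour}` from
`…HypersurfacesCharTwoMilnorGap.lean` (p570085), and `campaignW46HypersurfacesFields_two_all_rev2`.

REV 3 (same seat, gen 7, APPEND-ONLY: the fifteen rev-1/rev-2 theorems are byte-identical; one import added): closers of the
three rev-3 predicates `CampaignW46Hypersurfaces{HilbertThreeNonIsolatedExists, SidewaysForced}`, `CampaignW46ThreefoldsPointPhaseDichotomy`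
from `…HypersurfacesCharTwoSidewaysForced.lean` (p572265), and `campaignW46HypersurfacesFields_two_all_rev3`.

References: [CasasAlvero2000] §3 (context); [GreuelPfister2026] (context); [Hironaka2017] Th. 16.6 p.84 — role
replaced only, under adjudication.
-/

noncomputable section

-- single-problem summit: the doubled namespace component `ResolutionOfSingularities` is forced
set_option linter.dupNamespace false

open scoped Classical

namespace Summit.ResolutionOfSingularities.ResolutionOfSingularities.Theorems

open CampaignW46.HypersurfacesCharTwo

/-- [OURS · L1 W4.6 rung (ii), every `n`, every field; NOT a statement of the manuscript]
`CampaignW46HypersurfacesNullPolarNear 2 n` holds (`hypersurface_exists_double_successor_of_null_polar`): a null polar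
is an infinitely-near double point, rational over the field of definition. [folklore] -/
theorem campaignW46HypersurfacesNullPolarNear_two (n : ℕ) : CampaignW46HypersurfacesNullPolarNear 2 n :=
  fun _ _ _ c _ hM hI hlam0 hlam hnull => hypersurface_exists_double_successor_of_null_polar c hM hI hlam0 hlam hnull

/-- [OURS · L1 W4.6 rung (ii), every `n`, every field; NOT a statement of the manuscript]
`CampaignW46HypersurfacesHilbertTwoNearExists 2 n` holds
(`hypersurface_exists_double_successor_of_two_le_milnorHilbertTwo`): at `h₂ ≥ 2` a near double point exists over
every field. [folklore] -/
theorem campaignW46HypersurfacesHilbertTwoNearExists_two (n : ℕ) : CampaignW46HypersurfacesHilbertTwoNearExists 2 n :=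
  fun _ _ _ c hM hI he hh => hypersurface_exists_double_successor_of_two_le_milnorHilbertTwo c hM hI he hh

/-- [OURS · L1 W4.6 rung (ii), every `n`, every field; NOT a statement of the manuscript]
`CampaignW46HypersurfacesFreePointIsNullPolar 2 n` holds (`hypersurface_free_successor_at_null_polar`): the free near
point is the null polar. [folklore] -/
theorem campaignW46HypersurfacesFreePointIsNullPolar_two (n : ℕ) : CampaignW46HypersurfacesFreePointIsNullPolar 2 n :=
  fun _ _ _ c _ i τ hM he hlam0 hlam hnull hM' he' =>
    hypersurface_free_successor_at_null_polar c hM he hlam0 hlam hnull i τ hM' he'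

/-- [OURS · L1 W4.6 rung (ii), every `n`, every field; NOT a statement of the manuscript]
`CampaignW46HypersurfacesNullPolarCubeCriterion 2 n` holds (`hypersurface_exists_free_iff_null_polar_not_satellite`):
the cube criterion without the satellite. [folklore] -/
theorem campaignW46HypersurfacesNullPolarCubeCriterion_two (n : ℕ) :
    CampaignW46HypersurfacesNullPolarCubeCriterion 2 n :=
  fun _ _ _ c _ hM hI he hlam0 hlam hnull =>
    hypersurface_exists_free_iff_null_polar_not_satellite c hM hI he hlam0 hlam hnull

/-- [OURS · L1 W4.6 rung (ii), every `n`, every field; NOT a statement of the manuscript]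
`CampaignW46HypersurfacesNullPolarDichotomy 2 n` holds (`hypersurface_null_polar_dichotomy`): at `(2,2)` the null
polar is free with every other near point a satellite, or it is the satellite and the only near point. [folklore] -/
theorem campaignW46HypersurfacesNullPolarDichotomy_two (n : ℕ) : CampaignW46HypersurfacesNullPolarDichotomy 2 n :=
  fun _ _ _ c _ hM hI he hh hlam0 hlam hnull => hypersurface_null_polar_dichotomy c hM hI he hh hlam0 hlam hnull

/-- [OURS · L1 W4.6 rung (ii), every `n`, every field; NOT a statement of the manuscript]
`CampaignW46HypersurfacesHilbertTwoCensusAnyField 2 n` holds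
(`hypersurface_near_census_anyField_of_milnorHilbertTwo_eq_two`): the `(2,2)` census over the field of definition.
[folklore] -/
theorem campaignW46HypersurfacesHilbertTwoCensusAnyField_two (n : ℕ) :
    CampaignW46HypersurfacesHilbertTwoCensusAnyField 2 n :=
  fun _ _ _ c hM hI he hh => hypersurface_near_census_anyField_of_milnorHilbertTwo_eq_two c hM hI he hh

/-- [OURS · L1 W4.6 rung (ii), every `n`, separably closed field; NOT a statement of the manuscript]
`CampaignW46HypersurfacesSepClosedNearExists 2 n` holds (`hypersurface_exists_double_successor_of_isSepClosed`): in
corank `≥ 2` a near double point exists over a separably closed field. [folklore] -/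
theorem campaignW46HypersurfacesSepClosedNearExists_two (n : ℕ) : CampaignW46HypersurfacesSepClosedNearExists 2 n :=
  fun _ _ _ _ c hM hI he => hypersurface_exists_double_successor_of_isSepClosed c hM hI he

/-- [OURS · L1 W4.6 rung (ii), every `n`, separably closed field; NOT a statement of the manuscript]
`CampaignW46HypersurfacesSepClosedSecondNear 2 n` holds
(`hypersurface_exists_second_near_of_not_null_of_isSepClosed`): next to a non-null near point a second one.
[folklore] -/
theorem campaignW46HypersurfacesSepClosedSecondNear_two (n : ℕ) : CampaignW46HypersurfacesSepClosedSecondNear 2 n :=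
  fun _ _ _ _ c _ hM he hw₁0 hw₁ hc₁ hnn =>
    hypersurface_exists_second_near_of_not_null_of_isSepClosed c hM he hw₁0 hw₁ hc₁ hnn

/-- [OURS · L1 W4.6 rung (ii), every `n`, separably closed field; NOT a statement of the manuscript]
`CampaignW46HypersurfacesThreeTangentsSepClosed 2 n` holds (`hypersurface_three_near_points_of_isSepClosed`): exactly
three infinitely-near double points in the three-tangents class, over a separably closed field.
[cite: CasasAlvero2000, §3] -/
theorem campaignW46HypersurfacesThreeTangentsSepClosed_two (n : ℕ) : CampaignW46HypersurfacesThreeTangentsSepClosed 2 n :=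
  fun _ _ _ _ c hM hI he hh => hypersurface_three_near_points_of_isSepClosed c hM hI he hh

/-- [OURS · L1 W4.6 rung (ii), every `n ≥ 3`, separably closed field; NOT a statement of the manuscript]
`CampaignW46HypersurfacesResolvedInOneIffMuLeTwo 2 n` holds (`hypersurface_resolved_in_one_iff_mu_le_two_of_isSepClosed`):
resolved by one point blow-up iff `μ ≤ 2`. [folklore] -/
theorem campaignW46HypersurfacesResolvedInOneIffMuLeTwo_two (n : ℕ) :
    CampaignW46HypersurfacesResolvedInOneIffMuLeTwo 2 n :=
  fun _ _ _ _ c hn hM hI => hypersurface_resolved_in_one_iff_mu_le_two_of_isSepClosed hn c hM hI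

/-- [OURS · L1 W4.6 rung (ii) at `p = 2`, every `n`; NOT a statement of the manuscript] The field-of-definition
package at `p = 2`, all ten predicates at once. [folklore] -/
theorem campaignW46HypersurfacesFields_two_all (n : ℕ) :
    CampaignW46HypersurfacesNullPolarNear 2 n ∧ CampaignW46HypersurfacesHilbertTwoNearExists 2 n ∧
      CampaignW46HypersurfacesFreePointIsNullPolar 2 n ∧ CampaignW46HypersurfacesNullPolarCubeCriterion 2 n ∧
      CampaignW46HypersurfacesNullPolarDichotomy 2 n ∧ CampaignW46HypersurfacesHilbertTwoCensusAnyField 2 n ∧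
      CampaignW46HypersurfacesSepClosedNearExists 2 n ∧ CampaignW46HypersurfacesSepClosedSecondNear 2 n ∧
      CampaignW46HypersurfacesThreeTangentsSepClosed 2 n ∧ CampaignW46HypersurfacesResolvedInOneIffMuLeTwo 2 n :=
  ⟨campaignW46HypersurfacesNullPolarNear_two n, campaignW46HypersurfacesHilbertTwoNearExists_two n,
    campaignW46HypersurfacesFreePointIsNullPolar_two n, campaignW46HypersurfacesNullPolarCubeCriterion_two n,
    campaignW46HypersurfacesNullPolarDichotomy_two n, campaignW46HypersurfacesHilbertTwoCensusAnyField_two n,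
    campaignW46HypersurfacesSepClosedNearExists_two n, campaignW46HypersurfacesSepClosedSecondNear_two n,
    campaignW46HypersurfacesThreeTangentsSepClosed_two n, campaignW46HypersurfacesResolvedInOneIffMuLeTwo_two n⟩

/-- [OURS · L1 W4.6 rung (ii), every `n`, every field; fields rev 2; NOT a statement of the manuscript]
`CampaignW46HypersurfacesMilnorTrichotomy 2 n` holds (`hypersurface_mu_trichotomy`): `μ ∈ {1, 2} ∪ [4, ∞)`, the
Milnor gap. [folklore] -/
theorem campaignW46HypersurfacesMilnorTrichotomy_two (n : ℕ) : CampaignW46HypersurfacesMilnorTrichotomy 2 n :=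
  fun _ _ _ c hM hI => hypersurface_mu_trichotomy c hM hI

/-- [OURS · L1 W4.6 rung (ii), every `n ≥ 3`, every field; fields rev 2; NOT a statement of the manuscript]
`CampaignW46HypersurfacesMuLeTwoResolved 2 n` holds (`hypersurface_resolved_in_one_of_mu_le_two`): `μ ≤ 2` ⇒ resolved
by one point blow-up, over every field. [folklore] -/
theorem campaignW46HypersurfacesMuLeTwoResolved_two (n : ℕ) : CampaignW46HypersurfacesMuLeTwoResolved 2 n :=
  fun _ _ _ c i τ hn hM hI hμ => hypersurface_resolved_in_one_of_mu_le_two hn c hM hI hμ i τ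

/-- [OURS · L1 W4.6 rung (ii), every `n ≥ 3`, every field; fields rev 2; NOT a statement of the manuscript]
`CampaignW46HypersurfacesNearForcesMuFour 2 n` holds (`hypersurface_four_le_mu_of_exists_double_successor`): an
infinitely-near double point forces `μ ≥ 4`. [folklore] -/
theorem campaignW46HypersurfacesNearForcesMuFour_two (n : ℕ) : CampaignW46HypersurfacesNearForcesMuFour 2 n :=
  fun _ _ _ c hn hM hI h => hypersurface_four_le_mu_of_exists_double_successor hn c hM hI h

/-- [OURS · L1 W4.6 rung (ii) at `p = 2`, every `n`; fields rev 2; NOT a statement of the manuscript] The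
field-of-definition package at `p = 2` with the Milnor gap, all thirteen predicates at once. [folklore] -/
theorem campaignW46HypersurfacesFields_two_all_rev2 (n : ℕ) :
    (CampaignW46HypersurfacesNullPolarNear 2 n ∧ CampaignW46HypersurfacesHilbertTwoNearExists 2 n ∧
      CampaignW46HypersurfacesFreePointIsNullPolar 2 n ∧ CampaignW46HypersurfacesNullPolarCubeCriterion 2 n ∧
      CampaignW46HypersurfacesNullPolarDichotomy 2 n ∧ CampaignW46HypersurfacesHilbertTwoCensusAnyField 2 n ∧
      CampaignW46HypersurfacesSepClosedNearExists 2 n ∧ CampaignW46HypersurfacesSepClosedSecondNear 2 n ∧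
      CampaignW46HypersurfacesThreeTangentsSepClosed 2 n ∧ CampaignW46HypersurfacesResolvedInOneIffMuLeTwo 2 n) ∧
      CampaignW46HypersurfacesMilnorTrichotomy 2 n ∧ CampaignW46HypersurfacesMuLeTwoResolved 2 n ∧
      CampaignW46HypersurfacesNearForcesMuFour 2 n :=
  ⟨campaignW46HypersurfacesFields_two_all n, campaignW46HypersurfacesMilnorTrichotomy_two n,
    campaignW46HypersurfacesMuLeTwoResolved_two n, campaignW46HypersurfacesNearForcesMuFour_two n⟩

/-- [OURS · L1 W4.6 rung (ii), every `n`, every field; fields rev 3; NOT a statement of the manuscript]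
`CampaignW46HypersurfacesHilbertThreeNonIsolatedExists 2 n` holds
(`hypersurface_exists_nonisolated_successor_of_milnorHilbertTwo_eq_three`): at `(2,3)` a non-isolated near double
point exists over every field. [folklore] -/
theorem campaignW46HypersurfacesHilbertThreeNonIsolatedExists_two (n : ℕ) :
    CampaignW46HypersurfacesHilbertThreeNonIsolatedExists 2 n :=
  fun _ _ _ c hM hI he hh => hypersurface_exists_nonisolated_successor_of_milnorHilbertTwo_eq_three c hM hI he hh

/-- [OURS · L1 W4.6 rung (ii), every `n`, separably closed field; fields rev 3; NOT a statement of the manuscript]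
`CampaignW46HypersurfacesSidewaysForced 2 n` holds (`hypersurface_sideways_forced_of_isSepClosed`): the sideways exit is
forced. [folklore] -/
theorem campaignW46HypersurfacesSidewaysForced_two (n : ℕ) : CampaignW46HypersurfacesSidewaysForced 2 n :=
  fun _ _ _ _ c hM hI h => hypersurface_sideways_forced_of_isSepClosed c hM hI h

/-- [OURS · L1 W4.6 rung (ii), `n = 3`, separably closed field; fields rev 3; NOT a statement of the manuscript]
`CampaignW46ThreefoldsPointPhaseDichotomy 2` holds (`threefold_point_phase_dichotomy_of_isSepClosed`): the hyperbolic
chain or the forced sideways exit. [folklore] -/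
theorem campaignW46ThreefoldsPointPhaseDichotomy_two : CampaignW46ThreefoldsPointPhaseDichotomy 2 :=
  fun _ _ _ _ c hM hI => threefold_point_phase_dichotomy_of_isSepClosed c hM hI

/-- [OURS · L1 W4.6 rung (ii) at `p = 2`, every `n`; fields rev 3; NOT a statement of the manuscript] The
field-of-definition package at `p = 2` with the Milnor gap and the forced sideways exit, all sixteen predicates at once.
[folklore] -/
theorem campaignW46HypersurfacesFields_two_all_rev3 (n : ℕ) :
    ((CampaignW46HypersurfacesNullPolarNear 2 n ∧ CampaignW46HypersurfacesHilbertTwoNearExists 2 n ∧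
      CampaignW46HypersurfacesFreePointIsNullPolar 2 n ∧ CampaignW46HypersurfacesNullPolarCubeCriterion 2 n ∧
      CampaignW46HypersurfacesNullPolarDichotomy 2 n ∧ CampaignW46HypersurfacesHilbertTwoCensusAnyField 2 n ∧
      CampaignW46HypersurfacesSepClosedNearExists 2 n ∧ CampaignW46HypersurfacesSepClosedSecondNear 2 n ∧
      CampaignW46HypersurfacesThreeTangentsSepClosed 2 n ∧ CampaignW46HypersurfacesResolvedInOneIffMuLeTwo 2 n) ∧
      CampaignW46HypersurfacesMilnorTrichotomy 2 n ∧ CampaignW46HypersurfacesMuLeTwoResolved 2 n ∧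
      CampaignW46HypersurfacesNearForcesMuFour 2 n) ∧
      CampaignW46HypersurfacesHilbertThreeNonIsolatedExists 2 n ∧ CampaignW46HypersurfacesSidewaysForced 2 n ∧
      CampaignW46ThreefoldsPointPhaseDichotomy 2 :=
  ⟨campaignW46HypersurfacesFields_two_all_rev2 n, campaignW46HypersurfacesHilbertThreeNonIsolatedExists_two n,
    campaignW46HypersurfacesSidewaysForced_two n, campaignW46ThreefoldsPointPhaseDichotomy_two⟩

end Summit.ResolutionOfSingularities.ResolutionOfSingularities.Theorems

end
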